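import Mathlib.LinearAlgebra.Dual.Lemmas
import Mathlib.LinearAlgebra.Isomorphisms
import Mathlib.LinearAlgebra.FiniteDimensional.Lemmas
import Mathlib.RingTheory.Finiteness.Finsupp
import Mathlib.Data.Int.LeastGreatest
import Literature.NumberTheory.DiophantineGeometry.FunctionFieldAdeles
import Literature.NumberTheory.DiophantineGeometry.FunctionFieldGenusRiemannTheoremProofs
import Literature.NumberTheory.DiophantineGeometry.FunctionFieldDivisorsResidueMap
import HarnessLib

/-!
# Adeles, Weil differentials and the Riemann–Roch theorem (the theorems of Stichtenoth §1.5)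

Sibling proof file of `Literature.NumberTheory.DiophantineGeometry.FunctionFieldAdeles`
(definitions: the adele space `Adele K F = 𝒜_F`, `𝒜_F(A)`, principal adeles, Weil differentials
`Ω_F`, `Ω_F(A)`, the `F`-action, `adeleEvalMap`, `differentialDivisor`) and of `FunctionFieldGenus` (genus, `ℓ`).
Following H. Stichtenoth, *Algebraic Function Fields and Codes*, 2nd ed. 2009, §1.5 (pp. 30–35 of
the held copy) it proves, for an algebraic function field `F/K` with full constant field `K`
(after a few preliminaries from §1.4 not yet in the tree: the group law of principal divisors,
Def. 1.4.3; `x ∈ ℒ(D) ↔ (x) + D ≥ 0`, Remark 1.4.5 (a); monotonicity of `deg`; and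
**Thm. 1.4.17 (b)** `exists_forall_ell_eq_of_le_degree` — `ℓ(A) = deg A + 1 - g` for `deg A ≥ c` —
with its form `exists_le_forall_ell_eq`, on top of `FunctionFieldGenusRiemannTheoremProofs`):

* **Thm. 1.5.4** `finrank_adeleQuotient`: `𝒜_F/(𝒜_F(A) + F)` is finite-dimensional over `K` of
  dimension `i(A) = ℓ(A) - deg A + g - 1` (with Step 1 `adeleEvalMap_surjective`,
  `adeleEvalMap_eq_zero_iff`; Step 2 = eq. (1.25) `finrank_ker_factor`; Step 3
  `adeleSubspace_sup_principalAdeles_eq_top`); **Cor. 1.5.5** `finrank_adeleQuotient_zero`.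
* **Lemma 1.5.7** `finrank_weilDifferentialSpace`: `dim_K Ω_F(A) = i(A)`; hence `Ω_F ≠ 0`
  (`exists_weilDifferential_ne_zero`).
* **Prop. 1.5.9** `exists_smul_eq_of_ne_zero`: `Ω_F` is one-dimensional over `F`.
* **Lemma 1.5.10** `exists_isGreatest_of_ne_zero`: for `ω ≠ 0` the set `M(ω)` of divisors `A`
  with `ω ∈ Ω_F(A)` has a greatest element, the divisor `(ω) = differentialDivisor ω`
  (Def. 1.5.11); **Remark 1.5.12** `mem_weilDifferentialSpace_iff_le_differentialDivisor`.
* **Prop. 1.5.13 (a)** `differentialDivisor_smul`: `(xω) = (x) + (ω)`; **(b)**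
  `isLinearlyEquivalent_differentialDivisor`: canonical divisors are linearly equivalent.
* **Thm. 1.5.14 (Duality Theorem)** `exists_linearEquiv_weilDifferentialSpace` /
  `ell_differentialDivisor_sub`: for `W = (ω)`, `x ↦ xω` is a `K`-isomorphism `ℒ(W - A) ≃ Ω_F(A)`,
  so `ℓ(W - A) = i(A)`.
* **Thm. 1.5.15 (Riemann–Roch)** `ell_eq_of_differentialDivisor`: `ℓ(A) = deg A + 1 - g + ℓ(W - A)`;
  **Cor. 1.5.16** `ell_differentialDivisor`, `degree_differentialDivisor`,
  `isCanonical_differentialDivisor` (`ℓ(W) = g`, `deg W = 2g - 2`); the **discharge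
  `riemann_roch_holds`** of the named fact `AlgFunctionField.riemann_roch` of `FunctionFieldGenus`.
* **Thm. 1.5.17** `ell_eq_degree_add_one_sub_genus` and the **discharge `ell_eq_of_lt_degree_holds`**
  of `AlgFunctionField.ell_eq_of_lt_degree`: `deg A ≥ 2g - 1 ⇒ ℓ(A) = deg A + 1 - g`.

## Proof architecture (as printed, with the Lean phrasing)

Write `Q(A) := 𝒜_F ⧸ (𝒜_F(A) + F)` and, for `A₁ ≤ A₂`, `π : Q(A₁) → Q(A₂)` for the natural
surjection (Mathlib `Submodule.factor`). Its kernel is `(𝒜_F(A₂) + F)/(𝒜_F(A₁) + F)`, the space of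
eq. (1.25), and we prove (1.25) in the form: `ker π` is finite-dimensional of dimension
`(deg A₂ - ℓ(A₂)) - (deg A₁ - ℓ(A₁))` (`finrank_ker_factor`). For `A₂ = A₁ + P` this is Steps 1–2
of the printed proof: `φ : 𝒜_F(A₁ + P) → F_P` is onto with kernel `𝒜_F(A₁)` (1.24), `ker π` is the
image `σ(𝒜_F(A₁ + P))` in `Q(A₁)`, `ker φ ⊆ ker σ`, and `φ(ker σ) = ψ(ℒ(A₁ + P))` for the residue map
`ψ` of Lemma 1.4.8 (this is the exactness of (1.26) at the middle term: an adele of `𝒜_F(A₂)` lying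
in `𝒜_F(A₁) + F` differs from a principal adele of `ℒ(A₂)` by an element of `𝒜_F(A₁)`), so that
`ker π ≅ 𝒜_F(A₂)/ker σ ≅ F_P/ψ(ℒ(A₂))` has dimension `deg P - (ℓ(A₂) - ℓ(A₁))`. The general case
follows by induction on `A₂ - A₁ ≥ 0`, kernels of composites of surjections adding up
(`finrank_ker_comp_eq_of_surjective`). Step 3 and the end of the proof are as printed, with
Thm. 1.4.17 (b) in the form `exists_le_forall_ell_eq` (proved first, as printed: `A₀` with
`g = deg A₀ - ℓ(A₀) + 1`, `c := deg A₀ + g`, `0 ≠ z ∈ ℒ(A - A₀)`, `A' = A + (z) ≥ A₀`).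
Lemma 1.5.7: `Ω_F(A) ≅ (𝒜_F/(𝒜_F(A)+F))^*` (`Ω_F(A)` is the annihilator of `𝒜_F(A) + F` by definition;
Mathlib's `Submodule.dualQuotEquivDualAnnihilator`). Prop. 1.5.9, Lemma 1.5.10, Prop. 1.5.13: as printed
(the dimension count (1.30) is Mathlib's `Submodule.finrank_sup_add_finrank_inf_eq`; the maximal
element of `M(ω)` is chosen by `Int.exists_greatest_of_bdd` on the degrees, bounded by Thm. 1.5.4
and Thm. 1.4.17 (b)). Duality: for `x ∈ ℒ(W - A)`, `(xω) = (x) + (ω) ≥ A`, so `xω ∈ Ω_F(A)`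
(Remark 1.5.12); `μ : x ↦ xω` is linear and injective, and onto because every `ω₁ ∈ Ω_F(A)` is
`xω` (Prop. 1.5.9) with `(x) + W = (ω₁) ≥ A`. Hence `ℓ(W - A) = dim Ω_F(A) = i(A)` (Lemma 1.5.7),
which is Riemann–Roch; `A = 0` and `A = W` give Cor. 1.5.16; for `deg A ≥ 2g - 1`,
`deg (W - A) < 0` forces `ℓ(W - A) = 0` (Cor. 1.4.12 (b)).

## References

* H. Stichtenoth, *Algebraic Function Fields and Codes*, 2nd ed., GTM 254, Springer 2009, §1.4
  (Def. 1.4.3, Remark 1.4.5, Thm. 1.4.17) and §1.5: Def. 1.5.1 – Thm. 1.5.17 (pp. 25–35).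
  doi:10.1007/978-3-540-76878-4
* B. Riemann (1857); G. Roch, J. reine angew. Math. 64 (1865); F. K. Schmidt, Math. Z. 33 (1931)
  (general constant fields); A. Weil, J. reine angew. Math. 179 (1938) (Weil differentials).
-/

noncomputable section

open scoped Classical
open Module

namespace Literature.NumberTheory.DiophantineGeometry.AlgFunctionField

universe u v

variable {K : Type u} {F : Type v} [Field K] [Field F] [Algebra K F]

/-! ### Preliminaries from §1.4: principal divisors, monotonicity of the degree, Thm. 1.4.17 (b) -/

/-- `(x y) = (x) + (y)` for `x, y ≠ 0` (Stichtenoth (1.17) and Def. 1.4.3: "`Princ(F)` is a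
subgroup of `Div(F)`, since `(xy) = (x) + (y)`"). [cite: Stichtenoth2009, Def. 1.4.3] -/
theorem principalDivisor_mul [IsAlgFunctionField K F] {x y : F} (hx : x ≠ 0) (hy : y ≠ 0) :
    principalDivisor K (x * y) = principalDivisor K x + principalDivisor K y := by
  ext v
  simp [principalDivisor_apply_of_ne_zero hx, principalDivisor_apply_of_ne_zero hy,
    principalDivisor_apply_of_ne_zero (mul_ne_zero hx hy), v.ord_mul_eq hx hy]

/-- `(x⁻¹) = -(x)` for `x ≠ 0` (Stichtenoth Def. 1.4.3; proof of Thm. 1.4.11: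
"`(x)₀ = (x⁻¹)_∞`"). [cite: Stichtenoth2009, Def. 1.4.3] -/
theorem principalDivisor_inv [IsAlgFunctionField K F] {x : F} (hx : x ≠ 0) :
    principalDivisor K x⁻¹ = -principalDivisor K x := by
  ext v
  simp [principalDivisor_apply_of_ne_zero hx, principalDivisor_apply_of_ne_zero (inv_ne_zero hx),
    v.ord_inv hx]

/-- `(x ^ n) = n • (x)` for `x ≠ 0` (iteration of (1.17)). [cite: Stichtenoth2009, Def. 1.4.3] -/
theorem principalDivisor_pow [IsAlgFunctionField K F] {x : F} (hx : x ≠ 0) (n : ℕ) :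
    principalDivisor K (x ^ n) = n • principalDivisor K x := by
  ext v
  simp [principalDivisor_apply_of_ne_zero hx, principalDivisor_apply_of_ne_zero (pow_ne_zero n hx),
    v.ord_pow hx]

/-- Remark 1.4.5 (a) in divisor form: for `x ≠ 0`, `x ∈ ℒ(D) ↔ (x) + D ≥ 0`
(Stichtenoth Def. 1.4.4: `ℒ(A) = {x | (x) ≥ -A} ∪ {0}`). [cite: Stichtenoth2009, Def. 1.4.4 and Remark 1.4.5(a)] -/
theorem mem_riemannRochSpace_iff_nonneg [IsAlgFunctionField K F] (D : Divisor K F) {x : F}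
    (hx : x ≠ 0) : x ∈ riemannRochSpace D ↔ 0 ≤ principalDivisor K x + D := by
  refine ⟨fun h ↦ add_comm D _ ▸ nonneg_add_principalDivisor_of_mem h hx,
    fun h ↦ mem_riemannRochSpace_of_neg_apply_le_ord hx fun v ↦ ?_⟩
  have hv := h v
  rw [Finsupp.coe_zero, Pi.zero_apply, Finsupp.add_apply, principalDivisor_apply_of_ne_zero hx] at hv
  omega

/-- `D ∼ D + (x)` for `x ≠ 0` (Stichtenoth Def. 1.4.3: `D ∼ D'` iff `D = D' + (y)` for some
`y ≠ 0`; here `D - (D + (x)) = (x⁻¹)`). [cite: Stichtenoth2009, Def. 1.4.3] -/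
theorem isLinearlyEquivalent_add_principalDivisor [IsAlgFunctionField K F] (D : Divisor K F)
    {x : F} (hx : x ≠ 0) : D.IsLinearlyEquivalent (D + principalDivisor K x) :=
  ⟨x⁻¹, inv_ne_zero hx, by rw [principalDivisor_inv hx]; abel⟩

/-- `D ∼ D - (x)` for `x ≠ 0` (Stichtenoth Def. 1.4.3). [cite: Stichtenoth2009, Def. 1.4.3] -/
theorem isLinearlyEquivalent_sub_principalDivisor (D : Divisor K F) {x : F} (hx : x ≠ 0) :
    D.IsLinearlyEquivalent (D - principalDivisor K x) :=
  ⟨x, hx, by abel⟩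

/-- The degree is monotone: `D ≤ D' → deg D ≤ deg D'` (Stichtenoth Def. 1.4.1: `deg P ≥ 1`).
[cite: Stichtenoth2009, Def. 1.4.1] -/
theorem Divisor.degree_mono {D D' : Divisor K F} (h : D ≤ D') : D.degree ≤ D'.degree := by
  have h0 : (0 : Divisor K F) ≤ D' - D := Finsupp.le_def.2 fun v ↦ by simpa using h v
  have := Divisor.degree_nonneg_of_nonneg h0
  rwa [map_sub, sub_nonneg] at this

/-- `deg (n • D) = n * deg D`. [folklore] -/
theorem Divisor.degree_nsmul (n : ℕ) (D : Divisor K F) : (n • D).degree = n * D.degree := by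
  rw [map_nsmul, nsmul_eq_mul]

/-- **Stichtenoth Thm. 1.4.17 (b) (Riemann's theorem)**: there is an integer `c`, depending only on
`F/K` (`K` the full constant field), such that `ℓ(A) = deg A + 1 - g` whenever `deg A ≥ c`. Proof as
printed: `A₀` with `g = deg A₀ - ℓ(A₀) + 1`, `c := deg A₀ + g`; if `deg A ≥ c` then
`ℓ(A - A₀) ≥ deg (A - A₀) + 1 - g ≥ 1` by (a), so there is `0 ≠ z ∈ ℒ(A - A₀)`; `A' := A + (z) ≥ A₀`
and `deg A - ℓ(A) = deg A' - ℓ(A') ≥ deg A₀ - ℓ(A₀) = g - 1` (Cor. 1.4.12 (a), Lemma 1.4.8); with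
(a) this is the equality. [cite: Stichtenoth2009, Thm. 1.4.17(b)] -/
theorem exists_forall_ell_eq_of_le_degree [IsAlgFunctionField K F] [IsIntegrallyClosedIn K F] :
    ∃ c : ℤ, ∀ A : Divisor K F, c ≤ A.degree → (ell A : ℤ) = A.degree + 1 - genus K F := by
  obtain ⟨A₀, hA₀⟩ := exists_degree_add_one_sub_ell_eq_genus (K := K) (F := F)
  refine ⟨A₀.degree + genus K F, fun A hA ↦ le_antisymm ?_ (degree_add_one_sub_genus_le_ell A)⟩
  have h1 : (1 : ℤ) ≤ ell (A - A₀) := by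
    have := degree_add_one_sub_genus_le_ell (K := K) (A - A₀)
    rw [map_sub] at this
    linarith
  obtain ⟨z, hz, hz0⟩ := exists_mem_ne_zero_of_ell_pos (D := A - A₀) (by exact_mod_cast h1)
  have hA' : A₀ ≤ A + principalDivisor K z := by
    have h := nonneg_add_principalDivisor_of_mem hz hz0
    intro v
    have hv := h v
    simp only [Finsupp.coe_zero, Pi.zero_apply, Finsupp.coe_add, Finsupp.coe_sub, Pi.add_apply,
      Pi.sub_apply] at hv ⊢
    linarith
  have hequiv := isLinearlyEquivalent_add_principalDivisor A hz0
  have h2 := degree_sub_ell_mono hA'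
  rw [← Divisor.degree_eq_of_isLinearlyEquivalent hequiv,
    ← ell_congr_of_isLinearlyEquivalent_holds hequiv] at h2
  linarith

/-- Thm. 1.4.17 (b), "the index of speciality vanishes for large degree", in the form used in §1.5
(proofs of Thm. 1.5.4, Prop. 1.5.9, Lemma 1.5.10): every divisor `A` is dominated by a divisor
`A₁ ≥ A` such that `ℓ(B) = deg B + 1 - g` for all `B ≥ A₁` (take `A₁ = A + m P` for a place `P`
and `m` with `deg A₁ ≥ c`; then `deg B ≥ deg A₁ ≥ c`). [cite: Stichtenoth2009, Thm. 1.4.17(b) and Thm. 1.5.4 (proof)] -/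
theorem exists_le_forall_ell_eq [IsAlgFunctionField K F] [IsIntegrallyClosedIn K F] (A : Divisor K F) :
    ∃ A₁ : Divisor K F, A ≤ A₁ ∧ ∀ B : Divisor K F, A₁ ≤ B → (ell B : ℤ) = B.degree + 1 - genus K F := by
  obtain ⟨c, hc⟩ := exists_forall_ell_eq_of_le_degree (K := K) (F := F)
  obtain ⟨P⟩ := nonempty_placeOver (K := K) (F := F)
  have hP : (1 : ℤ) ≤ P.degree := by exact_mod_cast PlaceOver.one_le_degree P
  set m : ℕ := (c - A.degree).toNat with hm
  refine ⟨A + m • Finsupp.single P 1, le_add_of_nonneg_right (nsmul_nonneg (by simp) m), fun B hB ↦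
    hc B ?_⟩
  have h1 := Divisor.degree_mono hB
  rw [map_add, Divisor.degree_nsmul, Divisor.degree_single, one_mul] at h1
  have h2 : c - A.degree ≤ m := by rw [hm]; exact Int.self_le_toNat _
  nlinarith

/-! ### A lemma of linear algebra: kernels of composites of surjections -/

/-- If `f : V₁ → V₂` is onto and `ker f`, `ker g` are finite-dimensional, then `ker (g ∘ f)` is
finite-dimensional of dimension `dim ker f + dim ker g` (`f` maps `ker (g ∘ f)` onto `ker g` with
kernel `ker f`). Used to chain eq. (1.25) of Stichtenoth's proof of Thm. 1.5.4 along
`A₁ ≤ A₂ ≤ A₃`. [folklore] -/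
theorem finrank_ker_comp_eq_of_surjective {V₁ V₂ V₃ : Type*} [AddCommGroup V₁] [Module K V₁]
    [AddCommGroup V₂] [Module K V₂] [AddCommGroup V₃] [Module K V₃]
    (f : V₁ →ₗ[K] V₂) (g : V₂ →ₗ[K] V₃) (hf : Function.Surjective f)
    [FiniteDimensional K (LinearMap.ker f)] [FiniteDimensional K (LinearMap.ker g)] :
    FiniteDimensional K (LinearMap.ker (g ∘ₗ f)) ∧
      finrank K (LinearMap.ker (g ∘ₗ f)) = finrank K (LinearMap.ker f) + finrank K (LinearMap.ker g) := by
  have hle : LinearMap.ker f ≤ LinearMap.ker (g ∘ₗ f) := fun x hx ↦ by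
    rw [LinearMap.mem_ker] at hx ⊢
    rw [LinearMap.comp_apply, hx, map_zero]
  let f' : LinearMap.ker (g ∘ₗ f) →ₗ[K] LinearMap.ker g :=
    LinearMap.codRestrict (LinearMap.ker g) (f ∘ₗ (LinearMap.ker (g ∘ₗ f)).subtype) fun x ↦
      LinearMap.mem_ker.2 (LinearMap.mem_ker.1 x.2)
  have hf' : Function.Surjective f' := by
    rintro ⟨y, hy⟩
    obtain ⟨x, rfl⟩ := hf y
    exact ⟨⟨x, LinearMap.mem_ker.2 (LinearMap.mem_ker.1 hy)⟩, rfl⟩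
  have hker : LinearMap.ker f' = (LinearMap.ker f).comap (LinearMap.ker (g ∘ₗ f)).subtype := by
    ext x
    simp only [LinearMap.mem_ker, Submodule.mem_comap, Submodule.subtype_apply, f']
    rw [Subtype.ext_iff]
    rfl
  have e : LinearMap.ker f' ≃ₗ[K] LinearMap.ker f :=
    (LinearEquiv.ofEq _ _ hker).trans (Submodule.comapSubtypeEquivOfLe hle)
  haveI : FiniteDimensional K (LinearMap.ker f') := e.symm.finiteDimensional
  haveI : FiniteDimensional K (LinearMap.ker (g ∘ₗ f) ⧸ LinearMap.ker f') :=
    f'.quotKerEquivRange.symm.finiteDimensional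
  haveI hfd : FiniteDimensional K (LinearMap.ker (g ∘ₗ f)) :=
    Module.Finite.of_submodule_quotient (LinearMap.ker f')
  refine ⟨hfd, ?_⟩
  have h1 := f'.finrank_range_add_finrank_ker
  rw [LinearMap.range_eq_top.2 hf', finrank_top, e.finrank_eq] at h1
  omega

section AlgFunctionField

variable [IsAlgFunctionField K F]

/-! ### Thm. 1.5.4, Step 1: `φ : 𝒜_F(A + P) → F_P` is onto with kernel `𝒜_F(A)` (eq. (1.24)) -/

/-- Step 1 of the proof of Stichtenoth Thm. 1.5.4: the map `φ : 𝒜_F(A₁ + P) → F_P`,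
`α ↦ (t α_P)(P)`, is surjective ("one checks easily that `φ` is surjective": a residue class
`y(P)` is hit by the adele supported at `P` with component `t⁻¹ y`).
[cite: Stichtenoth2009, Thm. 1.5.4 (proof, Step 1)] -/
theorem adeleEvalMap_surjective (P : PlaceOver K F) (D : Divisor K F) :
    Function.Surjective (adeleEvalMap P D) := by
  intro r
  obtain ⟨y, rfl⟩ := IsLocalRing.residue_surjective r
  set a : F := (y : F) * (P.uniformizer : F) ^ (-(D P + 1)) with ha
  have hmem : Adele.single P a ∈ adeleSubspace (D + Finsupp.single P 1) := by
    rw [single_mem_adeleSubspace_iff]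
    simp only [Finsupp.coe_add, Pi.add_apply, Finsupp.single_eq_same]
    rw [ha, map_mul, map_zpow₀]
    exact mul_le_of_le_one_left' (P.toValuationSubring.valuation_le_one y)
  refine ⟨⟨Adele.single P a, hmem⟩, ?_⟩
  rw [adeleEvalMap_apply]
  congr 1
  apply Subtype.ext
  change (Adele.single P a : Adele K F) P * (P.uniformizer : F) ^ (D P + 1) = (y : F)
  rw [Adele.single_apply_self, ha, mul_assoc, ← zpow_add₀ P.coe_uniformizer_ne_zero,
    neg_add_cancel, zpow_zero, mul_one]

/-- Step 1 of the proof of Stichtenoth Thm. 1.5.4: the kernel of `φ : 𝒜_F(A₁ + P) → F_P` is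
`𝒜_F(A₁)` ("`φ(α) = 0` iff `v_P(t α_P) > 0` iff `v_P(α) ≥ -v_P(A₁)`", by discreteness of `v_P`).
[cite: Stichtenoth2009, Thm. 1.5.4 (proof, Step 1)] -/
theorem adeleEvalMap_eq_zero_iff (P : PlaceOver K F) (D : Divisor K F)
    (α : adeleSubspace (D + Finsupp.single P 1)) :
    adeleEvalMap P D α = 0 ↔ (α : Adele K F) ∈ adeleSubspace D := by
  rw [adeleEvalMap_apply, IsLocalRing.residue_eq_zero_iff, ValuationSubring.valuation_lt_one_iff,
    PlaceOver.valuation_lt_one_iff_le]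
  change P.valuation ((α : Adele K F) P * (P.uniformizer : F) ^ (D P + 1))
    ≤ _ ↔ _
  have hπ := P.valuation_uniformizer_ne_zero
  have hsplit : P.valuation (P.uniformizer : F) =
      P.valuation (P.uniformizer : F) ^ (-(D P)) * P.valuation (P.uniformizer : F) ^ (D P + 1) := by
    rw [← zpow_add₀ hπ, show -(D P) + (D P + 1) = 1 by ring, zpow_one]
  have key : P.valuation ((α : Adele K F) P) ≤
      P.valuation (P.uniformizer : F) ^ (-(D P)) ↔
      P.valuation ((α : Adele K F) P * (P.uniformizer : F) ^ (D P + 1)) ≤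
        P.valuation (P.uniformizer : F) := by
    rw [← mul_le_mul_iff_left₀ (zpow_pos (zero_lt_iff.2 hπ) (D P + 1)), ← hsplit, map_mul,
      map_zpow₀]
  rw [← key, mem_adeleSubspace_iff]
  constructor
  · intro h Q
    by_cases hQ : Q = P
    · subst hQ; exact h
    · have h2 := α.2 Q
      simp only [Finsupp.coe_add, Pi.add_apply, Finsupp.single_eq_of_ne hQ, add_zero] at h2
      exact h2
  · intro h
    exact h P

/-! ### Thm. 1.5.4, Step 2: eq. (1.25) -/

omit [IsAlgFunctionField K F] in
/-- `A₁ ≤ A₂ → 𝒜_F(A₁) + F ≤ 𝒜_F(A₂) + F` (Stichtenoth, proof of Thm. 1.5.4, Step 2: the natural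
map `(𝒜_F(A₂)+F)/(𝒜_F(A₁)+F)`). [cite: Stichtenoth2009, Thm. 1.5.4 (proof, Step 2)] -/
theorem adeleSubspace_sup_mono [IsAlgFunctionField K F] {A₁ A₂ : Divisor K F} (h : A₁ ≤ A₂) :
    adeleSubspace A₁ ⊔ principalAdeles K F ≤ adeleSubspace A₂ ⊔ principalAdeles K F :=
  sup_le_sup_right (adeleSubspace_mono h) _

/-- The kernel of the natural surjection `Q(A₁) → Q(A₂)` (`Q(A) = 𝒜_F/(𝒜_F(A)+F)`, `A₁ ≤ A₂`) is
the image of `𝒜_F(A₂)` in `Q(A₁)`, i.e. the space `(𝒜_F(A₂) + F)/(𝒜_F(A₁) + F)` of eq. (1.25).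
[cite: Stichtenoth2009, Thm. 1.5.4 (proof, Step 2)] -/
theorem ker_factor_eq_range {A₁ A₂ : Divisor K F} (h : A₁ ≤ A₂) :
    LinearMap.ker (Submodule.factor (adeleSubspace_sup_mono h)) =
      LinearMap.range ((adeleSubspace A₁ ⊔ principalAdeles K F).mkQ ∘ₗ (adeleSubspace A₂).subtype) := by
  rw [Submodule.factor, Submodule.ker_mapQ, Submodule.comap_id, Submodule.map_sup, LinearMap.range_comp,
    Submodule.range_subtype]
  refine sup_eq_left.2 ?_
  rintro _ ⟨γ, hγ, rfl⟩
  rw [Submodule.mkQ_apply, (Submodule.Quotient.mk_eq_zero _).2 (Submodule.mem_sup_right hγ)]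
  exact zero_mem _

/-- **Eq. (1.25) for `A₂ = A₁ + P`** (Steps 1–2 of the proof of Stichtenoth Thm. 1.5.4): the kernel
of `Q(A₁) → Q(A₁ + P)` is finite-dimensional of dimension
`(deg (A₁+P) - ℓ(A₁+P)) - (deg A₁ - ℓ(A₁)) = deg P - dim ℒ(A₁+P)/ℒ(A₁)`. Proof: with
`σ : 𝒜_F(A₁+P) → Q(A₁)` (whose range is the kernel) and `φ` of Step 1, `ker φ = 𝒜_F(A₁) ⊆ ker σ`
and `φ(ker σ) = ψ(ℒ(A₁+P))` (exactness of (1.26) in the middle: if `α ∈ 𝒜_F(A₁+P)` lies in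
`𝒜_F(A₁) + F`, say `α = β + x`, then `x ∈ 𝒜_F(A₁+P) ∩ F = ℒ(A₁+P)` and `φ(α) = φ(x) = ψ(x)`), so
`range σ ≅ 𝒜_F(A₁+P)/ker σ ≅ F_P/ψ(ℒ(A₁+P))`, of dimension `deg P - (ℓ(A₁+P) - ℓ(A₁))` by
`Ker ψ = ℒ(A₁)` (Lemma 1.4.8). (`B` is `A + P`, kept as a variable with an equation so that the
statement can be chained.) [cite: Stichtenoth2009, Thm. 1.5.4 (proof, Steps 1–2, (1.24)–(1.26))] -/
theorem finrank_ker_factor_add_single (A B : Divisor K F) (P : PlaceOver K F) (hAB : A ≤ B)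
    (hB : B = A + Finsupp.single P 1) :
    FiniteDimensional K (LinearMap.ker (Submodule.factor (adeleSubspace_sup_mono hAB))) ∧
    (finrank K (LinearMap.ker (Submodule.factor (adeleSubspace_sup_mono hAB))) : ℤ) =
      (B.degree - ell B) - (A.degree - ell A) := by
  subst hB
  haveI : FiniteDimensional K P.residueField := PlaceOver.finiteDimensional_residueField_holds P
  haveI := finiteDimensional_riemannRochSpace_of_isAlgFunctionField (K := K) (A + Finsupp.single P 1)
  set p := adeleSubspace A ⊔ principalAdeles K F with hp
  set Λ₂ := adeleSubspace (A + Finsupp.single P 1) with hΛ₂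
  rw [ker_factor_eq_range hAB]
  set σ : Λ₂ →ₗ[K] (Adele K F ⧸ p) := p.mkQ ∘ₗ Λ₂.subtype with hσ
  set φ := adeleEvalMap P A with hφ
  have hφsurj : Function.Surjective φ := adeleEvalMap_surjective P A
  -- on principal adeles `φ` is the residue map `ψ = evalMap` of Lemma 1.4.8 (same formula)
  have hφdiag : ∀ (x : F) (hx : x ∈ riemannRochSpace (A + Finsupp.single P 1)),
      adeleEvalMap P A ⟨algebraMap F (Adele K F) x, (algebraMap_mem_adeleSubspace_iff _ _).2 hx⟩ =
        P.evalMap A ⟨x, hx⟩ := fun _ _ ↦ rfl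
  -- `ker φ ≤ ker σ`
  have hker : LinearMap.ker φ ≤ LinearMap.ker σ := fun α hα ↦ by
    rw [LinearMap.mem_ker, hφ, adeleEvalMap_eq_zero_iff] at hα
    rw [LinearMap.mem_ker, hσ, LinearMap.comp_apply, Submodule.subtype_apply, Submodule.mkQ_apply,
      Submodule.Quotient.mk_eq_zero]
    exact Submodule.mem_sup_left hα
  -- `φ(ker σ) = range ψ`
  have hW : (LinearMap.ker σ).map φ = LinearMap.range (P.evalMap A) := by
    apply le_antisymm
    · rintro r ⟨α, hα, rfl⟩
      rw [SetLike.mem_coe, LinearMap.mem_ker, hσ, LinearMap.comp_apply, Submodule.subtype_apply,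
        Submodule.mkQ_apply, Submodule.Quotient.mk_eq_zero, hp, Submodule.mem_sup] at hα
      obtain ⟨β, hβ, γ, hγ, hβγ⟩ := hα
      obtain ⟨x, rfl⟩ := (mem_principalAdeles_iff γ).1 hγ
      have hβ₂ : β ∈ Λ₂ := adeleSubspace_mono hAB hβ
      have hx : x ∈ riemannRochSpace (A + Finsupp.single P 1) := by
        rw [← algebraMap_mem_adeleSubspace_iff, eq_sub_of_add_eq' hβγ]
        exact sub_mem α.2 hβ₂
      have hsplit : α = ⟨β, hβ₂⟩ + ⟨algebraMap F (Adele K F) x,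
          (algebraMap_mem_adeleSubspace_iff _ _).2 hx⟩ := Subtype.ext hβγ.symm
      refine ⟨⟨x, hx⟩, ?_⟩
      rw [hsplit, map_add, hφ, hφdiag x hx]
      have h0 : adeleEvalMap P A ⟨β, hβ₂⟩ = 0 := (adeleEvalMap_eq_zero_iff P A _).2 hβ
      rw [h0, zero_add]
    · rintro r ⟨x, rfl⟩
      refine ⟨⟨algebraMap F (Adele K F) x, (algebraMap_mem_adeleSubspace_iff _ _).2 x.2⟩, ?_,
        hφdiag x x.2⟩
      rw [SetLike.mem_coe, LinearMap.mem_ker, hσ, LinearMap.comp_apply, Submodule.subtype_apply,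
        Submodule.mkQ_apply, Submodule.Quotient.mk_eq_zero]
      exact Submodule.mem_sup_right (algebraMap_mem_principalAdeles _)
  -- `dim range ψ + ℓ(A) = ℓ(A+P)`
  have hψ : finrank K (LinearMap.range (P.evalMap A)) + ell A = ell (A + Finsupp.single P 1) := by
    have := (P.evalMap A).finrank_range_add_finrank_ker
    rw [(P.kerEvalMapEquiv A).finrank_eq] at this
    exact this
  -- `range σ ≃ Λ₂ / ker σ ≃ F_P / φ(ker σ)`
  set W := (LinearMap.ker σ).map φ with hWdef
  have hθsurj : Function.Surjective (W.mkQ ∘ₗ φ) :=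
    (Submodule.mkQ_surjective W).comp hφsurj
  have hθker : LinearMap.ker (W.mkQ ∘ₗ φ) = LinearMap.ker σ := by
    rw [LinearMap.ker_comp, Submodule.ker_mkQ, hWdef, Submodule.comap_map_eq, sup_eq_left]
    exact hker
  have e : LinearMap.range σ ≃ₗ[K] (P.residueField ⧸ W) :=
    σ.quotKerEquivRange.symm.trans ((Submodule.quotEquivOfEq _ _ hθker.symm).trans
      ((W.mkQ ∘ₗ φ).quotKerEquivOfSurjective hθsurj))
  haveI : FiniteDimensional K (LinearMap.range σ) := e.symm.finiteDimensional
  refine ⟨inferInstance, ?_⟩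
  have h1 : finrank K (P.residueField ⧸ W) + finrank K W = finrank K P.residueField :=
    W.finrank_quotient_add_finrank
  have h2 : (finrank K P.residueField : ℤ) = P.degree := rfl
  have h3 : finrank K (LinearMap.range σ) = finrank K (P.residueField ⧸ W) := e.finrank_eq
  have h4 : finrank K W + ell A = ell (A + Finsupp.single P 1) := by rw [hW]; exact hψ
  show (finrank K (LinearMap.range σ) : ℤ) =
    (A + Finsupp.single P 1).degree - ell (A + Finsupp.single P 1) - (A.degree - ell A)
  rw [degree_add_single]
  omega

/-- The case `A₁ = A₂` of (1.25): the kernel of `Q(A) → Q(A)` (the identity) is trivial.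
[cite: Stichtenoth2009, Thm. 1.5.4 (proof, Step 2)] -/
theorem finrank_ker_factor_self (A : Divisor K F) (hAA : A ≤ A) :
    FiniteDimensional K (LinearMap.ker (Submodule.factor (adeleSubspace_sup_mono hAA))) ∧
    (finrank K (LinearMap.ker (Submodule.factor (adeleSubspace_sup_mono hAA))) : ℤ) =
      (A.degree - ell A) - (A.degree - ell A) := by
  have hbot : LinearMap.ker (Submodule.factor (adeleSubspace_sup_mono hAA)) = ⊥ := by
    rw [LinearMap.ker_eq_bot']
    intro q hq
    induction q using Submodule.Quotient.induction_on with
    | H α => simpa using hq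
  rw [hbot]
  exact ⟨inferInstance, by simp⟩

/-- Chaining (1.25) along `B₁ ≤ B₂ ≤ B₃`: `Q(B₁) → Q(B₃)` is `Q(B₂) → Q(B₃)` after `Q(B₁) → Q(B₂)`,
and kernels of composites of surjections add up (`finrank_ker_comp_eq_of_surjective`).
[cite: Stichtenoth2009, Thm. 1.5.4 (proof, Step 2, "the general case follows by induction")] -/
theorem finrank_ker_factor_trans {B₁ B₂ B₃ : Divisor K F} (h₁₂ : B₁ ≤ B₂) (h₂₃ : B₂ ≤ B₃)
    (h₁₃ : B₁ ≤ B₃)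
    (H₁₂ : FiniteDimensional K (LinearMap.ker (Submodule.factor (adeleSubspace_sup_mono h₁₂))) ∧
      (finrank K (LinearMap.ker (Submodule.factor (adeleSubspace_sup_mono h₁₂))) : ℤ) =
        (B₂.degree - ell B₂) - (B₁.degree - ell B₁))
    (H₂₃ : FiniteDimensional K (LinearMap.ker (Submodule.factor (adeleSubspace_sup_mono h₂₃))) ∧
      (finrank K (LinearMap.ker (Submodule.factor (adeleSubspace_sup_mono h₂₃))) : ℤ) =
        (B₃.degree - ell B₃) - (B₂.degree - ell B₂)) :
    FiniteDimensional K (LinearMap.ker (Submodule.factor (adeleSubspace_sup_mono h₁₃))) ∧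
      (finrank K (LinearMap.ker (Submodule.factor (adeleSubspace_sup_mono h₁₃))) : ℤ) =
        (B₃.degree - ell B₃) - (B₁.degree - ell B₁) := by
  haveI := H₁₂.1
  haveI := H₂₃.1
  have hcomp : Submodule.factor (adeleSubspace_sup_mono h₁₃) =
      (Submodule.factor (adeleSubspace_sup_mono h₂₃)) ∘ₗ (Submodule.factor (adeleSubspace_sup_mono h₁₂)) :=
    (Submodule.factor_comp _ _).symm
  rw [hcomp]
  have := finrank_ker_comp_eq_of_surjective (Submodule.factor (adeleSubspace_sup_mono h₁₂))
    (Submodule.factor (adeleSubspace_sup_mono h₂₃)) (Submodule.factor_surjective _)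
  refine ⟨this.1, ?_⟩
  rw [this.2]
  push_cast
  rw [H₁₂.2, H₂₃.2]
  ring

/-- (1.25) for `B = A + n P`, by induction on `n` from `finrank_ker_factor_add_single`.
[cite: Stichtenoth2009, Thm. 1.5.4 (proof, Step 2)] -/
theorem finrank_ker_factor_add_single_natCast (P : PlaceOver K F) (n : ℕ) (A B : Divisor K F)
    (hAB : A ≤ B) (hB : B = A + Finsupp.single P (n : ℤ)) :
    FiniteDimensional K (LinearMap.ker (Submodule.factor (adeleSubspace_sup_mono hAB))) ∧
    (finrank K (LinearMap.ker (Submodule.factor (adeleSubspace_sup_mono hAB))) : ℤ) =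
      (B.degree - ell B) - (A.degree - ell A) := by
  induction n generalizing A B with
  | zero =>
    simp only [Nat.cast_zero, Finsupp.single_zero, add_zero] at hB
    subst hB
    exact finrank_ker_factor_self B hAB
  | succ n ih =>
    have h1 : A ≤ A + Finsupp.single P (n : ℤ) :=
      le_add_of_nonneg_right (Finsupp.single_nonneg.2 (Int.natCast_nonneg n))
    have h2 : A + Finsupp.single P (n : ℤ) ≤ B := by
      rw [hB, Nat.cast_succ, Finsupp.single_add, ← add_assoc]
      exact le_add_of_nonneg_right (Finsupp.single_nonneg.2 zero_le_one)
    exact finrank_ker_factor_trans h1 h2 hAB (ih A _ h1 rfl)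
      (finrank_ker_factor_add_single _ B P h2 (by rw [hB, Nat.cast_succ, Finsupp.single_add, add_assoc]))

/-- **Eq. (1.25) (Stichtenoth Thm. 1.5.4, Step 2)**: for `A₁ ≤ A₂` the space
`(𝒜_F(A₂) + F)/(𝒜_F(A₁) + F)` — the kernel of `Q(A₁) → Q(A₂)` — is finite-dimensional of dimension
`(deg A₂ - ℓ(A₂)) - (deg A₁ - ℓ(A₁))`. By induction from the case `A₂ = A₁ + P`
(`finrank_ker_factor_add_single`), "the general case follows by induction".
[cite: Stichtenoth2009, Thm. 1.5.4 (proof, Step 2, (1.25))] -/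
theorem finrank_ker_factor {A₁ A₂ : Divisor K F} (h : A₁ ≤ A₂) :
    FiniteDimensional K (LinearMap.ker (Submodule.factor (adeleSubspace_sup_mono h))) ∧
    (finrank K (LinearMap.ker (Submodule.factor (adeleSubspace_sup_mono h))) : ℤ) =
      (A₂.degree - ell A₂) - (A₁.degree - ell A₁) := by
  suffices H : ∀ E : Divisor K F, 0 ≤ E → ∀ (A B : Divisor K F) (hAB : A ≤ B), B = A + E →
      FiniteDimensional K (LinearMap.ker (Submodule.factor (adeleSubspace_sup_mono hAB))) ∧
      (finrank K (LinearMap.ker (Submodule.factor (adeleSubspace_sup_mono hAB))) : ℤ) =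
        (B.degree - ell B) - (A.degree - ell A) from
    H (A₂ - A₁) (sub_nonneg.2 h) A₁ A₂ h (add_sub_cancel A₁ A₂).symm
  intro E
  induction E using Finsupp.induction with
  | zero =>
    intro _ A B hAB hB
    rw [add_zero] at hB
    subst hB
    exact finrank_ker_factor_self B hAB
  | single_add a b f ha hb ih =>
    intro hE A B hAB hB
    have hfa : f a = 0 := Finsupp.notMem_support_iff.1 ha
    have hb' : 0 ≤ b := by
      have := Finsupp.le_def.1 hE a
      simpa [hfa] using this
    have hf : 0 ≤ f := Finsupp.le_def.2 fun w ↦ by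
      by_cases hw : a = w
      · subst hw
        simp [hfa]
      · have := Finsupp.le_def.1 hE w
        simpa [Finsupp.single_apply, hw] using this
    obtain ⟨n, rfl⟩ := Int.eq_ofNat_of_zero_le hb'
    have hAf : A ≤ A + f := le_add_of_nonneg_right hf
    have hfB : A + f ≤ B := by
      rw [hB, add_comm (Finsupp.single a _) f, ← add_assoc]
      exact le_add_of_nonneg_right (Finsupp.single_nonneg.2 (Int.natCast_nonneg n))
    exact finrank_ker_factor_trans hAf hfB hAB (ih hf A (A + f) hAf rfl)
      (finrank_ker_factor_add_single_natCast a n (A + f) B hfB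
        (by rw [hB, add_comm (Finsupp.single a _) f, add_assoc]))

/-! ### Thm. 1.5.4, Step 3 and conclusion; Cor. 1.5.5 -/

/-- **Step 3 of the proof of Stichtenoth Thm. 1.5.4, eq. (1.27)**: if `ℓ(B₁) = deg B₁ + 1 - g` for
all `B₁ ≥ B` (eq. (1.28), which the book derives from `ℓ(B) = deg B + 1 - g` by Lemma 1.4.8 and
Riemann's theorem), then `𝒜_F = 𝒜_F(B) + F`: given `α`, pick `B₁ ≥ B` with `α ∈ 𝒜_F(B₁)`; by (1.25)
`dim (𝒜_F(B₁)+F)/(𝒜_F(B)+F) = (g-1) - (g-1) = 0`, so `α ∈ 𝒜_F(B₁) ⊆ 𝒜_F(B) + F`.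
[cite: Stichtenoth2009, Thm. 1.5.4 (proof, Step 3, (1.27)–(1.28))] -/
theorem adeleSubspace_sup_principalAdeles_eq_top {B : Divisor K F}
    (hB : ∀ B₁ : Divisor K F, B ≤ B₁ → (ell B₁ : ℤ) = B₁.degree + 1 - genus K F) :
    adeleSubspace B ⊔ principalAdeles K F = ⊤ := by
  rw [eq_top_iff]
  intro α _
  obtain ⟨B₁, hBB₁, hα⟩ := exists_mem_adeleSubspace α B
  obtain ⟨hfd, hdim⟩ := finrank_ker_factor hBB₁
  haveI := hfd
  have h0 : finrank K (LinearMap.ker (Submodule.factor (adeleSubspace_sup_mono hBB₁))) = 0 := by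
    have h1 := hB B₁ hBB₁
    have h2 := hB B le_rfl
    omega
  rw [Submodule.finrank_eq_zero] at h0
  have hinj := LinearMap.ker_eq_bot.1 h0
  have h1 : Submodule.factor (adeleSubspace_sup_mono hBB₁)
      ((adeleSubspace B ⊔ principalAdeles K F).mkQ α) = 0 := by
    rw [Submodule.factor_mk, Submodule.mkQ_apply, Submodule.Quotient.mk_eq_zero]
    exact Submodule.mem_sup_left hα
  rw [← map_zero (Submodule.factor (adeleSubspace_sup_mono hBB₁))] at h1
  have h2 := hinj h1
  rwa [Submodule.mkQ_apply, Submodule.Quotient.mk_eq_zero] at h2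

/-- **Stichtenoth Thm. 1.5.4**: for every divisor `A` of `F/K` (`K` the full constant field) the
quotient `𝒜_F/(𝒜_F(A) + F)` is finite-dimensional over `K`, of dimension the index of speciality
`i(A) = ℓ(A) - deg A + g - 1`. End of the printed proof: by Thm. 1.4.17 (b) there is `A₁ ≥ A` with
`ℓ(B) = deg B + 1 - g` for all `B ≥ A₁`; by Step 3 `𝒜_F = 𝒜_F(A₁) + F`, and (1.25) gives
`dim 𝒜_F/(𝒜_F(A)+F) = (deg A₁ - ℓ(A₁)) - (deg A - ℓ(A)) = (g - 1) + ℓ(A) - deg A = i(A)`.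
[cite: Stichtenoth2009, Thm. 1.5.4] -/
theorem finrank_adeleQuotient [IsIntegrallyClosedIn K F] (A : Divisor K F) :
    FiniteDimensional K (Adele K F ⧸ (adeleSubspace A ⊔ principalAdeles K F)) ∧
    (finrank K (Adele K F ⧸ (adeleSubspace A ⊔ principalAdeles K F)) : ℤ) = specialityIndex K A := by
  obtain ⟨A₁, hAA₁, hA₁⟩ := exists_le_forall_ell_eq (K := K) (F := F) A
  obtain ⟨hfd, hdim⟩ := finrank_ker_factor hAA₁
  haveI := hfd
  have htop := adeleSubspace_sup_principalAdeles_eq_top hA₁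
  have hker : LinearMap.ker (Submodule.factor (adeleSubspace_sup_mono hAA₁)) = ⊤ := by
    haveI : Subsingleton (Adele K F ⧸ (adeleSubspace A₁ ⊔ principalAdeles K F)) :=
      Submodule.Quotient.subsingleton_iff.2 htop
    exact LinearMap.ker_eq_top.2 (Subsingleton.elim _ _)
  rw [hker] at hfd hdim
  haveI := hfd
  refine ⟨(Submodule.topEquiv :
    (⊤ : Submodule K (Adele K F ⧸ (adeleSubspace A ⊔ principalAdeles K F))) ≃ₗ[K] _).finiteDimensional, ?_⟩
  rw [finrank_top] at hdim
  rw [hdim, specialityIndex_def, hA₁ A₁ le_rfl]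
  ring

/-- **Stichtenoth Cor. 1.5.5**: `g = dim 𝒜_F/(𝒜_F(0) + F)` (since `i(0) = ℓ(0) - 0 + g - 1 = g`,
`ℓ(0) = 1` by Lemma 1.4.7). [cite: Stichtenoth2009, Cor. 1.5.5] -/
theorem finrank_adeleQuotient_zero [IsIntegrallyClosedIn K F] :
    finrank K (Adele K F ⧸ (adeleSubspace (0 : Divisor K F) ⊔ principalAdeles K F)) = genus K F := by
  have h := (finrank_adeleQuotient (K := K) (F := F) 0).2
  rw [specialityIndex_def, ell_zero_eq_one, map_zero] at h
  omega

/-! ### Lemma 1.5.7: `dim Ω_F(A) = i(A)`; `Ω_F ≠ 0` -/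

/-- **Stichtenoth Lemma 1.5.7**: `Ω_F(A)` is finite-dimensional over `K` with `dim Ω_F(A) = i(A)`
("`Ω_F(A)` is in a natural way isomorphic to the space of linear forms on `𝒜_F/(𝒜_F(A)+F)`", which
is finite-dimensional of dimension `i(A)` by Thm. 1.5.4). [cite: Stichtenoth2009, Lemma 1.5.7] -/
theorem finrank_weilDifferentialSpace [IsIntegrallyClosedIn K F] (A : Divisor K F) :
    FiniteDimensional K (weilDifferentialSpace A) ∧
      (finrank K (weilDifferentialSpace A) : ℤ) = specialityIndex K A := by
  obtain ⟨hfd, hdim⟩ := finrank_adeleQuotient (K := K) (F := F) A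
  haveI := hfd
  let e : Module.Dual K (Adele K F ⧸ (adeleSubspace A ⊔ principalAdeles K F)) ≃ₗ[K]
      weilDifferentialSpace A :=
    Submodule.dualQuotEquivDualAnnihilator _
  refine ⟨e.finiteDimensional, ?_⟩
  rw [← e.finrank_eq, Subspace.dual_finrank_eq, hdim]

/-- `Ω_F ≠ 0` ("a simple consequence of Lemma 1.5.7": for `deg A ≤ -2`,
`dim Ω_F(A) = i(A) = ℓ(A) - deg A + g - 1 ≥ 1`; we take `A = -2P` for a place `P`).
[cite: Stichtenoth2009, Lemma 1.5.7 (consequence, p. 32)] -/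
theorem exists_weilDifferential_ne_zero [IsIntegrallyClosedIn K F] :
    ∃ ω : weilDifferential K F, ω ≠ 0 := by
  obtain ⟨P⟩ := nonempty_placeOver (K := K) (F := F)
  set A : Divisor K F := Finsupp.single P (-2) with hA
  obtain ⟨hfd, hdim⟩ := finrank_weilDifferentialSpace (K := K) (F := F) A
  haveI := hfd
  have hdeg : A.degree = -2 * P.degree := by rw [hA, Divisor.degree_single]
  have hP : (1 : ℤ) ≤ P.degree := by exact_mod_cast PlaceOver.one_le_degree P
  have hpos : 0 < finrank K (weilDifferentialSpace A) := by
    have h0 : (0 : ℤ) ≤ ell A := Int.natCast_nonneg _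
    have hg : (0 : ℤ) ≤ genus K F := Int.natCast_nonneg _
    rw [specialityIndex_def, hdeg] at hdim
    have : (0 : ℤ) < finrank K (weilDifferentialSpace A) := by rw [hdim]; nlinarith
    exact_mod_cast this
  obtain ⟨ω, hω⟩ :=
    (Module.finrank_pos_iff_exists_ne_zero (R := K) (M := weilDifferentialSpace A)).1 hpos
  refine ⟨⟨ω, weilDifferentialSpace_le_weilDifferential A ω.2⟩, fun h ↦ hω (Subtype.ext ?_)⟩
  have h' := congrArg Subtype.val h
  exact h'

/-! ### Prop. 1.5.9: `Ω_F` is one-dimensional over `F` -/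

omit [IsAlgFunctionField K F] in
/-- `x ω = 0` with `x ≠ 0` forces `ω = 0` (`Ω_F` is an `F`-vector space, Def. 1.5.8).
[cite: Stichtenoth2009, Def. 1.5.8] -/
theorem weilDifferential.eq_zero_of_smul_eq_zero [IsAlgFunctionField K F] {x : F} (hx : x ≠ 0)
    {ω : weilDifferential K F} (h : x • ω = 0) : ω = 0 := by
  rw [← one_smul F ω, ← inv_mul_cancel₀ hx, mul_smul, h, smul_zero]

/-- For `ω ∈ Ω_F(A)` and `x ∈ ℒ(A + B)`: `x ω ∈ Ω_F(-B)` (the maps `φᵢ : ℒ(Aᵢ + B) → Ω_F(-B)`,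
`x ↦ x ωᵢ` of the proof of Prop. 1.5.9: `x ω ∈ Ω_F(A + (x))` and `A + (x) ≥ -B`).
[cite: Stichtenoth2009, Prop. 1.5.9 (proof)] -/
theorem smul_mem_weilDifferentialSpace_neg {A B : Divisor K F} {ω : weilDifferential K F}
    (hω : (ω : Module.Dual K (Adele K F)) ∈ weilDifferentialSpace A) {x : F}
    (hx : x ∈ riemannRochSpace (A + B)) :
    ((x • ω : weilDifferential K F) : Module.Dual K (Adele K F)) ∈ weilDifferentialSpace (-B) := by
  by_cases hx0 : x = 0
  · rw [hx0, zero_smul]; exact zero_mem _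
  have h1 := smul_mem_weilDifferentialSpace hx0 (D := A) (D' := A + principalDivisor K x)
    (fun v ↦ by simp [principalDivisor_apply_of_ne_zero hx0]) hω
  refine weilDifferentialSpace_antitone ?_ h1
  have := (mem_riemannRochSpace_iff_nonneg _ hx0).1 hx
  exact Finsupp.le_def.2 fun v ↦ by
    have hv := Finsupp.le_def.1 this v
    simp only [Finsupp.coe_zero, Pi.zero_apply, Finsupp.coe_add, Pi.add_apply, Finsupp.coe_neg,
      Pi.neg_apply] at hv ⊢
    linarith

/-- **Stichtenoth Prop. 1.5.9**: `Ω_F` is a one-dimensional `F`-vector space — for `ω₁ ≠ 0` every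
Weil differential is `z ω₁` for some `z ∈ F`. Proof as printed: `ωᵢ ∈ Ω_F(Aᵢ)`; for a divisor
`B > 0` of large degree (so that `ℓ(Aᵢ + B) = deg (Aᵢ + B) + 1 - g`, Thm. 1.4.17 (b), and
`ℓ(-B) = 0`), the injections `φᵢ : ℒ(Aᵢ + B) → Ω_F(-B)`, `x ↦ x ωᵢ`, have images `Uᵢ` with
`dim U₁ + dim U₂ - dim Ω_F(-B) = deg B + deg A₁ + deg A₂ + 3(1 - g) > 0`, so by (1.30)
`U₁ ∩ U₂ ≠ 0`: `x₁ ω₁ = x₂ ω₂ ≠ 0` and `ω₂ = (x₁ x₂⁻¹) ω₁`. [cite: Stichtenoth2009, Prop. 1.5.9] -/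
theorem exists_smul_eq_of_ne_zero [IsIntegrallyClosedIn K F] {ω₁ : weilDifferential K F}
    (h₁ : ω₁ ≠ 0) (ω₂ : weilDifferential K F) : ∃ z : F, ω₂ = z • ω₁ := by
  by_cases h₂ : ω₂ = 0
  · exact ⟨0, by rw [h₂, zero_smul]⟩
  obtain ⟨A₁, hA₁⟩ := exists_mem_weilDifferentialSpace ω₁
  obtain ⟨A₂, hA₂⟩ := exists_mem_weilDifferentialSpace ω₂
  obtain ⟨c, hc⟩ := exists_forall_ell_eq_of_le_degree (K := K) (F := F)
  obtain ⟨P⟩ := nonempty_placeOver (K := K) (F := F)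
  have hP : (1 : ℤ) ≤ P.degree := by exact_mod_cast PlaceOver.one_le_degree P
  -- a divisor `B = m P` of large degree
  set m : ℕ := (c - A₁.degree).toNat + (c - A₂.degree).toNat +
    (3 * (genus K F : ℤ) - A₁.degree - A₂.degree).toNat + 1 with hm
  set B : Divisor K F := Finsupp.single P (m : ℤ) with hB
  have hdegB : B.degree = m * P.degree := by rw [hB, Divisor.degree_single]
  have hm1 : (c - A₁.degree : ℤ) ≤ m := by
    rw [hm]; push_cast; have := Int.self_le_toNat (c - A₁.degree); omega
  have hm2 : (c - A₂.degree : ℤ) ≤ m := by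
    rw [hm]; push_cast; have := Int.self_le_toNat (c - A₂.degree); omega
  have hm3 : (3 * (genus K F : ℤ) - A₁.degree - A₂.degree : ℤ) < m := by
    rw [hm]; push_cast; have := Int.self_le_toNat (3 * (genus K F : ℤ) - A₁.degree - A₂.degree); omega
  have hmB : (m : ℤ) ≤ B.degree := by rw [hdegB]; nlinarith [hP, Int.natCast_nonneg m]
  have hBpos : 0 < B.degree := by omega
  -- dimensions
  have hℓ₁ : (ell (A₁ + B) : ℤ) = A₁.degree + B.degree + 1 - genus K F := by
    rw [hc (A₁ + B) (by rw [map_add]; omega), map_add]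
  have hℓ₂ : (ell (A₂ + B) : ℤ) = A₂.degree + B.degree + 1 - genus K F := by
    rw [hc (A₂ + B) (by rw [map_add]; omega), map_add]
  obtain ⟨hfdΩ, hdimΩ⟩ := finrank_weilDifferentialSpace (K := K) (F := F) (-B)
  haveI := hfdΩ
  have hℓB : ell (-B) = 0 := ell_eq_zero_of_degree_neg (by rw [map_neg]; omega)
  rw [specialityIndex_def, hℓB, map_neg, Nat.cast_zero, zero_sub, neg_neg] at hdimΩ
  -- the maps `φᵢ`, with values in the dual of `𝒜_F`
  haveI := finiteDimensional_riemannRochSpace_of_isAlgFunctionField (K := K) (A₁ + B)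
  haveI := finiteDimensional_riemannRochSpace_of_isAlgFunctionField (K := K) (A₂ + B)
  let φ : ∀ (ω : weilDifferential K F) (D : Divisor K F),
      riemannRochSpace D →ₗ[K] Module.Dual K (Adele K F) :=
    fun ω D ↦ (weilDifferential K F).subtype ∘ₗ
      ((LinearMap.toSpanSingleton F (weilDifferential K F) ω).restrictScalars K) ∘ₗ
        (riemannRochSpace D).subtype
  have hφ : ∀ (ω : weilDifferential K F) (D : Divisor K F) (x : riemannRochSpace D),
      φ ω D x = (((x : F) • ω : weilDifferential K F) : Module.Dual K (Adele K F)) :=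
    fun _ _ _ ↦ rfl
  have hinj : ∀ {ω : weilDifferential K F} (hω : ω ≠ 0) (D : Divisor K F),
      Function.Injective (φ ω D) := by
    intro ω hω D x y hxy
    rw [hφ, hφ] at hxy
    have hxy' : ((x : F) - y) • ω = 0 := by
      rw [sub_smul (x : F) (y : F) ω, sub_eq_zero]
      exact Subtype.ext hxy
    by_contra hne
    have hne' : (x : F) - y ≠ 0 := sub_ne_zero.2 fun h ↦ hne (Subtype.ext h)
    exact hω (weilDifferential.eq_zero_of_smul_eq_zero hne' hxy')
  set U₁ := LinearMap.range (φ ω₁ (A₁ + B)) with hU₁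
  set U₂ := LinearMap.range (φ ω₂ (A₂ + B)) with hU₂
  have hdimU₁ : finrank K U₁ = ell (A₁ + B) := LinearMap.finrank_range_of_inj (hinj h₁ _)
  have hdimU₂ : finrank K U₂ = ell (A₂ + B) := LinearMap.finrank_range_of_inj (hinj h₂ _)
  have hU₁le : U₁ ≤ weilDifferentialSpace (-B) := by
    rintro _ ⟨x, rfl⟩; rw [hφ]; exact smul_mem_weilDifferentialSpace_neg hA₁ x.2
  have hU₂le : U₂ ≤ weilDifferentialSpace (-B) := by
    rintro _ ⟨x, rfl⟩; rw [hφ]; exact smul_mem_weilDifferentialSpace_neg hA₂ x.2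
  haveI : FiniteDimensional K U₁ := Submodule.finiteDimensional_of_le hU₁le
  haveI : FiniteDimensional K U₂ := Submodule.finiteDimensional_of_le hU₂le
  -- (1.30)
  have hsup : finrank K ↥(U₁ ⊔ U₂) ≤ finrank K (weilDifferentialSpace (-B)) :=
    Submodule.finrank_mono (sup_le hU₁le hU₂le)
  have h130 := Submodule.finrank_sup_add_finrank_inf_eq U₁ U₂
  have hinfpos : 0 < finrank K ↥(U₁ ⊓ U₂) := by
    have : (0 : ℤ) < finrank K ↥(U₁ ⊓ U₂) := by
      have e1 : (finrank K ↥(U₁ ⊔ U₂) : ℤ) + finrank K ↥(U₁ ⊓ U₂) =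
          ell (A₁ + B) + ell (A₂ + B) := by
        rw [← hdimU₁, ← hdimU₂]; exact_mod_cast h130
      have e2 : (finrank K ↥(U₁ ⊔ U₂) : ℤ) ≤ finrank K (weilDifferentialSpace (-B)) := by
        exact_mod_cast hsup
      linarith
    exact_mod_cast this
  haveI : FiniteDimensional K ↥(U₁ ⊓ U₂) := Submodule.finiteDimensional_of_le inf_le_left
  obtain ⟨η, hη⟩ := (Module.finrank_pos_iff_exists_ne_zero (R := K) (M := ↥(U₁ ⊓ U₂))).1 hinfpos
  have hη0 : (η : Module.Dual K (Adele K F)) ≠ 0 := fun h ↦ hη (Subtype.ext h)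
  obtain ⟨⟨x₁, hx₁⟩, ⟨x₂, hx₂⟩⟩ := η.2
  rw [hφ] at hx₁ hx₂
  -- `x₁ ω₁ = x₂ ω₂ ≠ 0`
  have heq : ((x₂ : F) • ω₂ : weilDifferential K F) = (x₁ : F) • ω₁ :=
    Subtype.ext (hx₂.trans hx₁.symm)
  have hx₂0 : (x₂ : F) ≠ 0 := by
    rintro h
    rw [h, zero_smul] at hx₂
    exact hη0 hx₂.symm
  refine ⟨(x₂ : F)⁻¹ * x₁, ?_⟩
  rw [mul_smul, ← heq, ← mul_smul, inv_mul_cancel₀ hx₂0, one_smul]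

/-! ### Lemma 1.5.10 and Def. 1.5.11: the divisor of a Weil differential -/

/-- A Weil differential vanishing on `𝒜_F(A) + F` with `𝒜_F(A) + F = 𝒜_F` is zero; in particular
(Thm. 1.5.4 with Thm. 1.4.17 (b)) `ω ∈ Ω_F(A)` and `ω ≠ 0` force `deg A < c` (first paragraph of
the proof of Lemma 1.5.10). [cite: Stichtenoth2009, Lemma 1.5.10 (proof)] -/
theorem degree_lt_of_mem_weilDifferentialSpace {c : ℤ}
    (hc : ∀ A : Divisor K F, c ≤ A.degree → (ell A : ℤ) = A.degree + 1 - genus K F)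
    {ω : weilDifferential K F} (hω : ω ≠ 0) {A : Divisor K F}
    (hA : (ω : Module.Dual K (Adele K F)) ∈ weilDifferentialSpace A) : A.degree < c := by
  by_contra hle
  push Not at hle
  have htop : adeleSubspace A ⊔ principalAdeles K F = ⊤ :=
    adeleSubspace_sup_principalAdeles_eq_top fun B₁ hB₁ ↦ hc B₁ (hle.trans (Divisor.degree_mono hB₁))
  apply hω
  apply Subtype.ext
  apply LinearMap.ext
  intro α
  rw [mem_weilDifferentialSpace_iff, htop] at hA
  exact hA α Submodule.mem_top

/-- For `α ∈ 𝒜_F(W + Q)`, the adele `α - α''` (`α''` = `α` at `Q`, `0` elsewhere) lies in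
`𝒜_F(W)` (the decomposition `α = α' + α''` in the proof of Lemma 1.5.10).
[cite: Stichtenoth2009, Lemma 1.5.10 (proof)] -/
theorem sub_single_mem_adeleSubspace {W : Divisor K F} {Q : PlaceOver K F} {α : Adele K F}
    (hα : α ∈ adeleSubspace (W + Finsupp.single Q 1)) :
    α - Adele.single Q (α Q) ∈ adeleSubspace W := by
  intro v
  by_cases hv : v = Q
  · subst hv
    simp
  · have h := hα v
    simp only [Finsupp.coe_add, Pi.add_apply, Finsupp.single_eq_of_ne hv, add_zero] at h
    simpa [Adele.single_apply_of_ne hv] using h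

/-- **Stichtenoth Lemma 1.5.10**: for `0 ≠ ω ∈ Ω_F` there is a (unique) divisor `W` with
`ω ∈ Ω_F(W)` and `A ≤ W` for all `A` with `ω ∈ Ω_F(A)`, i.e. `M(ω)` has a greatest element. Proof
as printed: degrees of `A ∈ M(ω)` are `< c` (Thm. 1.5.4, Thm. 1.4.17 (b)), so choose `W ∈ M(ω)` of
maximal degree; if some `A₀ ∈ M(ω)` had `v_Q(A₀) > v_Q(W)`, then `W + Q ∈ M(ω)` (split
`α ∈ 𝒜_F(W + Q)` as `α' + α''` with `α' ∈ 𝒜_F(W)`, `α'' ∈ 𝒜_F(A₀)`), contradicting maximality.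
[cite: Stichtenoth2009, Lemma 1.5.10] -/
theorem exists_isGreatest_of_ne_zero [IsIntegrallyClosedIn K F] {ω : weilDifferential K F}
    (hω : ω ≠ 0) :
    ∃ W, IsGreatest {A : Divisor K F |
      (ω : Module.Dual K (Adele K F)) ∈ weilDifferentialSpace A} W := by
  obtain ⟨c, hc⟩ := exists_forall_ell_eq_of_le_degree (K := K) (F := F)
  -- a divisor of `M(ω)` of maximal degree
  obtain ⟨d, ⟨W, hW, rfl⟩, hmax⟩ := Int.exists_greatest_of_bdd
    (P := fun d ↦ ∃ A : Divisor K F,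
      (ω : Module.Dual K (Adele K F)) ∈ weilDifferentialSpace A ∧ A.degree = d)
    ⟨c, fun d ⟨A, hA, hd⟩ ↦ hd ▸ (degree_lt_of_mem_weilDifferentialSpace hc hω hA).le⟩
    (let ⟨A, hA⟩ := exists_mem_weilDifferentialSpace ω; ⟨A.degree, A, hA, rfl⟩)
  refine ⟨W, hW, fun A₀ hA₀ ↦ ?_⟩
  by_contra hnle
  obtain ⟨Q, hQ⟩ : ∃ Q, W Q < A₀ Q := by
    by_contra h
    push Not at h
    exact hnle (Finsupp.le_def.2 h)
  -- (1.32): `W + Q ∈ M(ω)`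
  have h132 : (ω : Module.Dual K (Adele K F)) ∈ weilDifferentialSpace (W + Finsupp.single Q 1) := by
    have hW' := hW
    have hA₀' : (ω : Module.Dual K (Adele K F)) ∈ weilDifferentialSpace A₀ := hA₀
    rw [mem_weilDifferentialSpace_iff'] at hW' hA₀' ⊢
    refine ⟨fun α hα ↦ ?_, hW'.2⟩
    have hsplit : α = (α - Adele.single Q (α Q)) + Adele.single Q (α Q) := (sub_add_cancel _ _).symm
    have h1 : (ω : Module.Dual K (Adele K F)) (α - Adele.single Q (α Q)) = 0 :=
      hW'.1 _ (sub_single_mem_adeleSubspace hα)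
    have h2 : (ω : Module.Dual K (Adele K F)) (Adele.single Q (α Q)) = 0 := by
      refine hA₀'.1 _ ((single_mem_adeleSubspace_iff Q _ A₀).2 ?_)
      have h := hα Q
      simp only [Finsupp.coe_add, Pi.add_apply, Finsupp.single_eq_same] at h
      exact h.trans (Q.zpow_valuation_uniformizer_le_of_le (by omega))
    rw [hsplit, map_add, h1, h2, add_zero]
  have hdeg := hmax _ ⟨_, h132, rfl⟩
  rw [degree_add_single] at hdeg
  have hQ1 : (1 : ℤ) ≤ Q.degree := by exact_mod_cast PlaceOver.one_le_degree Q
  omega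

/-- **Def. 1.5.11 (1)**: `ω` vanishes on `𝒜_F((ω)) + F`, i.e. `ω ∈ Ω_F((ω))`, for `ω ≠ 0`.
[cite: Stichtenoth2009, Def. 1.5.11 and Lemma 1.5.10] -/
theorem mem_weilDifferentialSpace_differentialDivisor [IsIntegrallyClosedIn K F]
    {ω : weilDifferential K F} (hω : ω ≠ 0) :
    (ω : Module.Dual K (Adele K F)) ∈ weilDifferentialSpace (differentialDivisor ω) :=
  (isGreatest_differentialDivisor (exists_isGreatest_of_ne_zero hω)).1

/-- **Def. 1.5.11 (2)**: if `ω ≠ 0` vanishes on `𝒜_F(A) + F` then `A ≤ (ω)`.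
[cite: Stichtenoth2009, Def. 1.5.11 and Lemma 1.5.10] -/
theorem le_differentialDivisor_of_mem [IsIntegrallyClosedIn K F] {ω : weilDifferential K F}
    (hω : ω ≠ 0) {A : Divisor K F}
    (hA : (ω : Module.Dual K (Adele K F)) ∈ weilDifferentialSpace A) : A ≤ differentialDivisor ω :=
  (isGreatest_differentialDivisor (exists_isGreatest_of_ne_zero hω)).2 hA

/-- **Stichtenoth Remark 1.5.12**: `Ω_F(A) = {ω | ω = 0 or (ω) ≥ A}` — for `ω ≠ 0`,
`ω ∈ Ω_F(A) ↔ A ≤ (ω)`. [cite: Stichtenoth2009, Remark 1.5.12] -/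
theorem mem_weilDifferentialSpace_iff_le_differentialDivisor [IsIntegrallyClosedIn K F]
    {ω : weilDifferential K F} (hω : ω ≠ 0) (A : Divisor K F) :
    (ω : Module.Dual K (Adele K F)) ∈ weilDifferentialSpace A ↔ A ≤ differentialDivisor ω :=
  ⟨le_differentialDivisor_of_mem hω,
    fun h ↦ weilDifferentialSpace_antitone h (mem_weilDifferentialSpace_differentialDivisor hω)⟩

/-- Uniqueness in Lemma 1.5.10 / Def. 1.5.11: a divisor with properties (1) and (2) is `(ω)`.
[cite: Stichtenoth2009, Lemma 1.5.10 and Def. 1.5.11] -/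
theorem differentialDivisor_eq_of_isGreatest [IsIntegrallyClosedIn K F] {ω : weilDifferential K F}
    (hω : ω ≠ 0) {W : Divisor K F}
    (hW : IsGreatest {A : Divisor K F |
      (ω : Module.Dual K (Adele K F)) ∈ weilDifferentialSpace A} W) :
    differentialDivisor ω = W :=
  (isGreatest_differentialDivisor (exists_isGreatest_of_ne_zero hω)).unique hW

/-! ### Prop. 1.5.13 (a): `(xω) = (x) + (ω)` -/

/-- `(ω) + (x) ≤ (xω)` for `x ≠ 0`, `ω ≠ 0` (first half of the proof of Prop. 1.5.13 (a): "if `ω`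
vanishes on `𝒜_F(A) + F` then `xω` vanishes on `𝒜_F(A + (x)) + F`").
[cite: Stichtenoth2009, Prop. 1.5.13 (proof)] -/
theorem differentialDivisor_add_principalDivisor_le [IsIntegrallyClosedIn K F] {x : F} (hx : x ≠ 0)
    {ω : weilDifferential K F} (hω : ω ≠ 0) :
    differentialDivisor ω + principalDivisor K x ≤ differentialDivisor (x • ω) :=
  le_differentialDivisor_of_mem (smul_ne_zero hx hω)
    (smul_mem_weilDifferentialSpace hx (fun v ↦ by simp [principalDivisor_apply_of_ne_zero hx])
      (mem_weilDifferentialSpace_differentialDivisor hω))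

/-- **Stichtenoth Prop. 1.5.13 (a)**: `(xω) = (x) + (ω)` for `0 ≠ x ∈ F`, `0 ≠ ω ∈ Ω_F` (as printed:
`(ω) + (x) ≤ (xω)` and `(xω) + (x⁻¹) ≤ (x⁻¹xω) = (ω)`). [cite: Stichtenoth2009, Prop. 1.5.13(a)] -/
theorem differentialDivisor_smul [IsIntegrallyClosedIn K F] {x : F} (hx : x ≠ 0)
    {ω : weilDifferential K F} (hω : ω ≠ 0) :
    differentialDivisor (x • ω) = principalDivisor K x + differentialDivisor ω := by
  apply le_antisymm
  · have h := differentialDivisor_add_principalDivisor_le (inv_ne_zero hx)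
      (smul_ne_zero hx hω)
    rw [← mul_smul, inv_mul_cancel₀ hx, one_smul, principalDivisor_inv hx] at h
    -- `h : (xω) - (x) ≤ (ω)`
    intro v
    have hv := h v
    simp only [Finsupp.coe_add, Finsupp.coe_neg, Pi.add_apply, Pi.neg_apply] at hv ⊢
    linarith
  · rw [add_comm]
    exact differentialDivisor_add_principalDivisor_le hx hω

end AlgFunctionField

section Duality

variable [IsAlgFunctionField K F] [IsIntegrallyClosedIn K F]

/-! ### Thm. 1.5.14: the Duality Theorem -/

/-- For `W = (ω)` (`ω ≠ 0`) and `x ∈ ℒ(W - A)`: `xω ∈ Ω_F(A)` (first step of the proof of the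
Duality Theorem: `(xω) = (x) + (ω) ≥ -(W - A) + W = A`, Remark 1.5.12).
[cite: Stichtenoth2009, Thm. 1.5.14 (proof)] -/
theorem smul_mem_weilDifferentialSpace_of_mem {ω : weilDifferential K F} (hω : ω ≠ 0)
    {A : Divisor K F} {x : F} (hx : x ∈ riemannRochSpace (differentialDivisor ω - A)) :
    ((x • ω : weilDifferential K F) : Module.Dual K (Adele K F)) ∈ weilDifferentialSpace A := by
  have h := smul_mem_weilDifferentialSpace_neg (B := -A)
    (mem_weilDifferentialSpace_differentialDivisor hω) (x := x) (by rwa [← sub_eq_add_neg])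
  rwa [neg_neg] at h

omit [IsIntegrallyClosedIn K F] in
/-- `x ↦ xω` is injective on `F` for `ω ≠ 0` ("clearly `μ` is linear and injective").
[cite: Stichtenoth2009, Thm. 1.5.14 (proof)] -/
theorem smul_left_injective_of_ne_zero {ω : weilDifferential K F} (hω : ω ≠ 0) :
    Function.Injective fun x : F ↦ x • ω := by
  intro x y hxy
  have hxy' : (x - y) • ω = 0 := by
    rw [sub_smul x y ω, sub_eq_zero]
    exact hxy
  by_contra hne
  exact hω (weilDifferential.eq_zero_of_smul_eq_zero (sub_ne_zero.2 hne) hxy')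

/-- **Stichtenoth Thm. 1.5.14 (Duality Theorem)**: for a divisor `A` and the canonical divisor
`W = (ω)` of a Weil differential `ω ≠ 0`, the map `μ : ℒ(W - A) → Ω_F(A)`, `x ↦ xω`, is an
isomorphism of `K`-vector spaces. Proof as printed: `μ` is well defined by Remark 1.5.12
(`smul_mem_weilDifferentialSpace_of_mem`), linear, injective; surjective since any `ω₁ ∈ Ω_F(A)` is
`xω` (Prop. 1.5.9) with `(x) + W = (xω) = (ω₁) ≥ A`, i.e. `x ∈ ℒ(W - A)`.
[cite: Stichtenoth2009, Thm. 1.5.14] -/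
theorem exists_linearEquiv_weilDifferentialSpace {ω : weilDifferential K F} (hω : ω ≠ 0)
    (A : Divisor K F) :
    ∃ μ : riemannRochSpace (differentialDivisor ω - A) ≃ₗ[K] weilDifferentialSpace A,
      ∀ x, (μ x : Module.Dual K (Adele K F)) = (((x : F) • ω : weilDifferential K F) :
        Module.Dual K (Adele K F)) := by
  set W := differentialDivisor ω with hW
  -- the map `μ`, with values in the dual of `𝒜_F`, then corestricted to `Ω_F(A)`
  let μ₀ : riemannRochSpace (W - A) →ₗ[K] Module.Dual K (Adele K F) :=
    (weilDifferential K F).subtype ∘ₗ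
      ((LinearMap.toSpanSingleton F (weilDifferential K F) ω).restrictScalars K) ∘ₗ
        (riemannRochSpace (W - A)).subtype
  have hμ₀ : ∀ x : riemannRochSpace (W - A),
      μ₀ x = (((x : F) • ω : weilDifferential K F) : Module.Dual K (Adele K F)) := fun _ ↦ rfl
  let μ : riemannRochSpace (W - A) →ₗ[K] weilDifferentialSpace A :=
    LinearMap.codRestrict (weilDifferentialSpace A) μ₀ fun x ↦ by
      rw [hμ₀]; exact smul_mem_weilDifferentialSpace_of_mem hω x.2
  have hμ : ∀ x, (μ x : Module.Dual K (Adele K F)) =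
      (((x : F) • ω : weilDifferential K F) : Module.Dual K (Adele K F)) := fun _ ↦ rfl
  have hinj : Function.Injective μ := by
    intro x y hxy
    have h1 : (μ x : Module.Dual K (Adele K F)) = μ y := by rw [hxy]
    rw [hμ, hμ] at h1
    exact Subtype.ext (smul_left_injective_of_ne_zero hω (Subtype.ext h1))
  have hsurj : Function.Surjective μ := by
    intro η
    -- `η = z ω` by Prop. 1.5.9
    obtain ⟨z, hz⟩ := exists_smul_eq_of_ne_zero hω ⟨η, weilDifferentialSpace_le_weilDifferential A η.2⟩
    by_cases hz0 : z = 0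
    · refine ⟨0, Subtype.ext ?_⟩
      have : (η : Module.Dual K (Adele K F)) = 0 := by
        have h := congrArg (fun ξ : weilDifferential K F ↦ (ξ : Module.Dual K (Adele K F))) hz
        simpa [hz0] using h
      rw [map_zero, this]
      rfl
    -- `(z) + W = (zω) = (η) ≥ A`, so `z ∈ ℒ(W - A)`
    have hzω : z • ω ≠ 0 := smul_ne_zero hz0 hω
    have hmem : ((z • ω : weilDifferential K F) : Module.Dual K (Adele K F)) ∈ weilDifferentialSpace A := by
      rw [← hz]; exact η.2
    have hle := le_differentialDivisor_of_mem hzω hmem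
    rw [differentialDivisor_smul hz0 hω] at hle
    have hzL : z ∈ riemannRochSpace (W - A) := by
      rw [mem_riemannRochSpace_iff_nonneg _ hz0]
      exact Finsupp.le_def.2 fun v ↦ by
        have hv := Finsupp.le_def.1 hle v
        simp only [Finsupp.coe_add, Pi.add_apply, Finsupp.coe_sub, Pi.sub_apply, Finsupp.coe_zero,
          Pi.zero_apply] at hv ⊢
        linarith
    refine ⟨⟨z, hzL⟩, Subtype.ext ?_⟩
    rw [hμ]
    exact (congrArg (fun ξ : weilDifferential K F ↦ (ξ : Module.Dual K (Adele K F))) hz).symm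
  exact ⟨LinearEquiv.ofBijective μ ⟨hinj, hsurj⟩, fun x ↦ hμ x⟩

/-- **Duality, numerical form** ("in particular `i(A) = ℓ(W - A)`"): for `ω ≠ 0` and every divisor
`A`, `ℓ((ω) - A) = dim Ω_F(A) = i(A) = ℓ(A) - deg A + g - 1` (Thm. 1.5.14 with Lemma 1.5.7).
[cite: Stichtenoth2009, Thm. 1.5.14] -/
theorem ell_differentialDivisor_sub {ω : weilDifferential K F} (hω : ω ≠ 0) (A : Divisor K F) :
    (ell (differentialDivisor ω - A) : ℤ) = specialityIndex K A := by
  obtain ⟨μ, -⟩ := exists_linearEquiv_weilDifferentialSpace hω A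
  obtain ⟨hfd, hdim⟩ := finrank_weilDifferentialSpace (K := K) (F := F) A
  rw [← hdim]
  exact_mod_cast μ.finrank_eq

/-! ### Thm. 1.5.15 (Riemann–Roch) and Cor. 1.5.16 -/

/-- **Stichtenoth Thm. 1.5.15 (Riemann–Roch Theorem)**: for the canonical divisor `W = (ω)` of any
Weil differential `ω ≠ 0` and every divisor `A`, `ℓ(A) = deg A + 1 - g + ℓ(W - A)` ("an immediate
consequence of Theorem 1.5.14 and the definition of `i(A)`"). [cite: Stichtenoth2009, Thm. 1.5.15] -/
theorem ell_eq_of_differentialDivisor {ω : weilDifferential K F} (hω : ω ≠ 0) (A : Divisor K F) :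
    (ell A : ℤ) = A.degree + 1 - genus K F + ell (differentialDivisor ω - A) := by
  rw [ell_differentialDivisor_sub hω A, specialityIndex_def]
  ring

/-- **Stichtenoth Cor. 1.5.16, first half**: `ℓ(W) = g` for a canonical divisor `W = (ω)`
(Riemann–Roch with `A = 0` and `ℓ(0) = 1`, Lemma 1.4.7). [cite: Stichtenoth2009, Cor. 1.5.16] -/
theorem ell_differentialDivisor {ω : weilDifferential K F} (hω : ω ≠ 0) :
    ell (differentialDivisor ω) = genus K F := by
  have h := ell_eq_of_differentialDivisor hω 0
  rw [ell_zero_eq_one, map_zero, sub_zero] at h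
  omega

/-- **Stichtenoth Cor. 1.5.16, second half**: `deg W = 2g - 2` for a canonical divisor `W = (ω)`
(Riemann–Roch with `A = W`: `g = ℓ(W) = deg W + 1 - g + ℓ(0)`). [cite: Stichtenoth2009, Cor. 1.5.16] -/
theorem degree_differentialDivisor {ω : weilDifferential K F} (hω : ω ≠ 0) :
    (differentialDivisor ω).degree = 2 * genus K F - 2 := by
  have h := ell_eq_of_differentialDivisor hω (differentialDivisor ω)
  rw [sub_self, ell_zero_eq_one, ell_differentialDivisor hω] at h
  omega

/-- The divisor of a nonzero Weil differential is canonical in the numerical sense of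
`Divisor.IsCanonical` (`deg W = 2g - 2` and `ℓ(W) = g`, Cor. 1.5.16; by Prop. 1.6.2 these two
conditions characterise canonical divisors). [cite: Stichtenoth2009, Cor. 1.5.16 and Prop. 1.6.2] -/
theorem isCanonical_differentialDivisor {ω : weilDifferential K F} (hω : ω ≠ 0) :
    (differentialDivisor ω).IsCanonical :=
  ⟨degree_differentialDivisor hω, ell_differentialDivisor hω⟩

/-- **Stichtenoth Prop. 1.5.13 (b)**: any two canonical divisors `(ω₁)`, `(ω₂)` (`ωᵢ ≠ 0`) are
linearly equivalent (from (a) and Prop. 1.5.9: `ω₂ = zω₁`, `(ω₂) = (z) + (ω₁)`).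
[cite: Stichtenoth2009, Prop. 1.5.13(b)] -/
theorem isLinearlyEquivalent_differentialDivisor {ω₁ ω₂ : weilDifferential K F} (h₁ : ω₁ ≠ 0)
    (h₂ : ω₂ ≠ 0) : (differentialDivisor ω₂).IsLinearlyEquivalent (differentialDivisor ω₁) := by
  obtain ⟨z, rfl⟩ := exists_smul_eq_of_ne_zero h₁ ω₂
  have hz : z ≠ 0 := by rintro rfl; exact h₂ (zero_smul _ _)
  refine ⟨z, hz, ?_⟩
  rw [differentialDivisor_smul hz h₁, add_sub_cancel_right]

omit [IsAlgFunctionField K F] [IsIntegrallyClosedIn K F] in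
/-- **Discharge of `AlgFunctionField.riemann_roch`** (the Riemann–Roch theorem as vendored in
`FunctionFieldGenus`: there is a canonical divisor `W` — numerically, `deg W = 2g - 2` and
`ℓ(W) = g` — with `ℓ(D) = deg D + 1 - g + ℓ(W - D)` for every divisor `D`, for `K` the full
constant field): take `W = (ω)` for any Weil differential `ω ≠ 0` (`Ω_F ≠ 0`,
`exists_weilDifferential_ne_zero`), Thm. 1.5.15 and Cor. 1.5.16.
[cite: Stichtenoth2009, Thm. 1.5.15 and Cor. 1.5.16] -/
theorem riemann_roch_holds : riemann_roch (K := K) (F := F) := by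
  intro _ _
  obtain ⟨ω, hω⟩ := exists_weilDifferential_ne_zero (K := K) (F := F)
  exact ⟨differentialDivisor ω, isCanonical_differentialDivisor hω,
    fun D ↦ ell_eq_of_differentialDivisor hω D⟩

/-! ### Thm. 1.5.17 -/

omit [IsAlgFunctionField K F] [IsIntegrallyClosedIn K F] in
/-- **Discharge of `AlgFunctionField.ell_eq_of_lt_degree` (Stichtenoth Thm. 1.5.17)**: for a
divisor `A` of an algebraic function field of one variable `F/K` with full constant field `K`,
`deg A > 2g - 2` (i.e. `deg A ≥ 2g - 1`) implies `ℓ(A) = deg A + 1 - g`. Proof as printed: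
`ℓ(A) = deg A + 1 - g + ℓ(W - A)` with `W = (ω)` canonical (Thm. 1.5.15, for any `ω ≠ 0`, which
exists as `Ω_F ≠ 0`); `deg A ≥ 2g - 1` and `deg W = 2g - 2` (Cor. 1.5.16) give `deg (W - A) < 0`,
so `ℓ(W - A) = 0` by Cor. 1.4.12 (b). [cite: Stichtenoth2009, Thm. 1.5.17] -/
theorem ell_eq_of_lt_degree_holds : ell_eq_of_lt_degree (K := K) (F := F) := by
  intro _ _ A hA
  obtain ⟨ω, hω⟩ := exists_weilDifferential_ne_zero (K := K) (F := F)
  have h := ell_eq_of_differentialDivisor hω A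
  have hlt : (differentialDivisor ω - A).degree < 0 := by
    rw [map_sub, degree_differentialDivisor hω]
    omega
  rwa [ell_eq_zero_of_degree_neg hlt, Nat.cast_zero, add_zero] at h

/-- **Stichtenoth Thm. 1.5.17**, pointwise form with the class hypotheses: if `deg A > 2g - 2` then
`ℓ(A) = deg A + 1 - g`. [cite: Stichtenoth2009, Thm. 1.5.17] -/
theorem ell_eq_degree_add_one_sub_genus {A : Divisor K F}
    (hA : 2 * (genus K F : ℤ) - 2 < A.degree) : (ell A : ℤ) = A.degree + 1 - genus K F :=
  ell_eq_of_lt_degree_holds hA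

end Duality

end Literature.NumberTheory.DiophantineGeometry.AlgFunctionField
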